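import Literature.AlgebraicGeometry.Motives.ProductChartStalks
import Literature.AlgebraicGeometry.Motives.FunctionFieldProductRelativeBasis
import Literature.AlgebraicGeometry.Motives.GroupSchemeTopFormFrame
import HarnessLib

/-!
# (W0) core, S7b: the chart-to-function-field map `j` and the identity `σ(pr₂♯ f) · j Δ = pr₂♯ f`

Topic `Literature/NumberTheory/DiophantineGeometry` (proofs only; no definitions, no named facts).
The function-field half («S7b») of step S7 «the relative Jacobian `Δ` of the group law on the
chart is a unit» in the étale heart of the (W0) argument (Bosch–Lütkebohmert–Raynaud, *Néron
Models*, §4.3, proof of Prop. 6; Edixhoven–Romagny Thm. 6.3): it supplies every hypothesis of the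
pure-ring lemma ★ `Literature.RingTheory.Localization.isUnit_of_cocycle_identity` except the unit
extraction `f · π^N = π^M · u` on the chart («S7a»).  Context: `𝒳 → Spec R` (any base ring), affine
charts `V₁, V₂ ⊆ 𝒳`, the product chart `c : Spec (Γ(V₁) ⊗_R Γ(V₂)) → 𝒳 ×_R 𝒳`
(★ `Motives.exists_productChart`), a chart ring `C` over it (in the cell `C = (Γ(V₁) ⊗ Γ(V₂))_h`)
with its open immersion `cC : Spec C → 𝒳 × 𝒳`, the chart-to-function-field map
`j := (cC♯)⁻¹ ∘ (C → K(Spec C)) : C → K(𝒳 × 𝒳)` (★ `RatFn.functionFieldEquiv`), the morphism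
`m : D → 𝒳` given on the chart by `m♯ : Γ(V₂) → C`, and the function-field endomorphism `σ` of
`Φ_D = (pr₁, m)` (★ `GenericFibreIsoPack`):

* `coreUnit_j_injective` (hj), `coreUnit_j_includeRight` («`j ∘ ι₂ = pr₂♯ ∘ i_{V₂}`», hφ₂),
  `coreUnit_j_includeLeft`, `coreUnit_j_includeRight_ne_zero` (hπ0) — from ★ `ProductChartStalks` §2;
* `coreUnit_j_ms` («`j ∘ m♯ = σ ∘ pr₂♯ ∘ i_{V₂}`», hμ) — along the chart `ℓ : Spec C → D`;
* `algebraMap_sections_algebraMap_eq`, `coreUnit_phi2_algebraMap_eq` (hπφ: `pr₂♯` and `σ ∘ pr₂♯`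
  agree on `R`), `coreUnit_sigma_comp_stalkHom` (the shear `σ` is `R`-linear when `Φ_D` is over `R`);
* `coreUnit_cocycle_identity` — **`σ(pr₂♯ f) · j Δ = pr₂♯ f`** for `f = f₀ · J`, `θ = (f₀, y₀)` the
  rational top form of ★ L4a′, `J = B_y.det B₀` the Jacobian towards the chart coordinates `y`,
  `Δ = α.det (d m♯yᵢ)` the relative Jacobian on `C`, from the L4c′ identity `hcocy`
  («`Φ^* pr₂^* θ = pr₂^* θ`») by three chain rules (★ `det_D_ringHom_eq` along `j`, `pr₂♯`,
  `σ ∘ pr₂♯`; the basis `d (σ pr₂♯ y₀ᵢ)` exists because its determinant is a unit by `hcocy`,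
  Mathlib `Module.Basis.is_basis_iff_det`) and the multiplicativity of determinants of bases.

Cell `hodgecm-mathlib`, road W of `r₀` ((W0) core S7b; S7 = ★ `isUnit_of_cocycle_identity` ∘
{S7a (B-p13), S7b}).

## Sources

* S. Bosch, W. Lütkebohmert, M. Raynaud, *Néron Models*, Ergebnisse (3) 21, Springer 1990, §4.3
  Prop. 6 (proof), §2.2 Prop. 11. [BLRNeronModels1990]
* U. Görtz, T. Wedhorn, *Algebraic Geometry I: Schemes*, 2nd ed., Springer Spektrum 2020, (3.4)–(3.5),
  Prop. 3.29, Prop. 9.34. [GortzWedhorn2020]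
-/

noncomputable section

universe u

namespace Literature.NumberTheory.DiophantineGeometry

open CategoryTheory Limits _root_.AlgebraicGeometry MonoidalCategory CartesianMonoidalCategory
open TensorProduct Literature.AlgebraicGeometry.Motives Literature.AlgebraicGeometry.Motives.RatFn
open Literature.AlgebraicGeometry.Smoothening

variable {R : Type u} [CommRing R] (𝒳 : Over (Spec (.of R)))
  [IsIntegral 𝒳.left] [IsIntegral (𝒳 ⊗ 𝒳).left]
  [IsDominant (fst 𝒳 𝒳).left] [IsDominant (snd 𝒳 𝒳).left]
  -- the two charts
  {V₁ V₂ : 𝒳.left.Opens} (hV₁ : IsAffineOpen V₁) (hV₂ : IsAffineOpen V₂) [Nonempty V₁] [Nonempty V₂]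
  [Algebra R Γ(𝒳.left, V₁)] [Algebra R Γ(𝒳.left, V₂)]
  -- the product chart `c`, a chart ring `C` over it (in the cell: `C = (Γ(V₁) ⊗ Γ(V₂))_h`), the chart
  -- `cC : Spec C → 𝒳 × 𝒳` and the chart-to-function-field map `j : C → K(𝒳 × 𝒳)`
  (c : Spec (.of (Γ(𝒳.left, V₁) ⊗[R] Γ(𝒳.left, V₂))) ⟶ (𝒳 ⊗ 𝒳).left)
  (C : CommRingCat.{u}) [IsDomain C] [Algebra (Γ(𝒳.left, V₁) ⊗[R] Γ(𝒳.left, V₂)) C]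
  (cC : Spec C ⟶ (𝒳 ⊗ 𝒳).left)
  (hcC : cC = Spec.map (CommRingCat.ofHom (algebraMap (Γ(𝒳.left, V₁) ⊗[R] Γ(𝒳.left, V₂)) C)) ≫ c)
  [IsOpenImmersion cC] [IsDominant cC]
  (j : C →+* (𝒳 ⊗ 𝒳).left.functionField)
  (hj : j = (functionFieldEquiv cC).symm.toRingHom.comp (algebraMap C (Spec C).functionField))

/-! ### The chart-to-function-field map `j : C → K(𝒳 ×_R 𝒳)` and the two projections -/

omit [IsIntegral 𝒳.left] [IsDominant (fst 𝒳 𝒳).left] [IsDominant (snd 𝒳 𝒳).left] in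
include hj in
/-- `j : C = (Γ(V₁) ⊗_R Γ(V₂))_h → K(𝒳 × 𝒳)` is injective (★ `injective_functionFieldEquiv_symm_comp_algebraMap`).
[cite: GortzWedhorn2020, Prop. 3.29 (1)] -/
theorem coreUnit_j_injective : Function.Injective j := by
  subst hj
  exact injective_functionFieldEquiv_symm_comp_algebraMap cC

omit [IsDominant (fst 𝒳 𝒳).left] [Nonempty V₁] in
include hcC hj in
/-- **`j ∘ ι₂ = pr₂♯ ∘ i_{V₂}`**: for a section `b ∈ Γ(𝒳, V₂)`, `j (loc (1 ⊗ b)) = pr₂♯ (b)` (★ PCS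
`functionFieldEquiv_symm_algebraMap_of_comp_eq_fromSpec` for the factorisation `c ≫ pr₂ = Spec ι₂ ≫ (Spec Γ(V₂) → 𝒳)`).
[cite: GortzWedhorn2020, Prop. 3.29 (1)–(2)] -/
theorem coreUnit_j_includeRight
    (hc₂ : c ≫ (snd 𝒳 𝒳).left = Spec.map (CommRingCat.ofHom (Algebra.TensorProduct.includeRight (R := R)
      (A := Γ(𝒳.left, V₁)) (B := Γ(𝒳.left, V₂))).toRingHom) ≫ hV₂.fromSpec) (b : Γ(𝒳.left, V₂)) :
    j (algebraMap _ C ((1 : Γ(𝒳.left, V₁)) ⊗ₜ[R] b)) =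
      functionFieldMap (snd 𝒳 𝒳).left (algebraMap Γ(𝒳.left, V₂) 𝒳.left.functionField b) := by
  subst hj
  have hfac : cC ≫ (snd 𝒳 𝒳).left =
      Spec.map (CommRingCat.ofHom ((algebraMap _ C).comp
        (Algebra.TensorProduct.includeRight (R := R) (A := Γ(𝒳.left, V₁))
          (B := Γ(𝒳.left, V₂))).toRingHom)) ≫ hV₂.fromSpec := by
    rw [hcC, Category.assoc, hc₂, ← Category.assoc, ← Spec.map_comp, ← CommRingCat.ofHom_comp]
  exact functionFieldEquiv_symm_algebraMap_of_comp_eq_fromSpec cC (snd 𝒳 𝒳).left hV₂ _ hfac b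

omit [IsDominant (snd 𝒳 𝒳).left] [Nonempty V₂] in
include hcC hj in
/-- **`j ∘ ι₁ = pr₁♯ ∘ i_{V₁}`**: for `b ∈ Γ(𝒳, V₁)`, `j (loc (b ⊗ 1)) = pr₁♯ (b)`.
[cite: GortzWedhorn2020, Prop. 3.29 (1)–(2)] -/
theorem coreUnit_j_includeLeft
    (hc₁ : c ≫ (fst 𝒳 𝒳).left =
      Spec.map (CommRingCat.ofHom Algebra.TensorProduct.includeLeftRingHom) ≫ hV₁.fromSpec)
    (b : Γ(𝒳.left, V₁)) :
    j (algebraMap _ C (b ⊗ₜ[R] (1 : Γ(𝒳.left, V₂)))) =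
      functionFieldMap (fst 𝒳 𝒳).left (algebraMap Γ(𝒳.left, V₁) 𝒳.left.functionField b) := by
  subst hj
  have hfac : cC ≫ (fst 𝒳 𝒳).left =
      Spec.map (CommRingCat.ofHom ((algebraMap _ C).comp
        (Algebra.TensorProduct.includeLeftRingHom (R := R) (A := Γ(𝒳.left, V₁))
          (B := Γ(𝒳.left, V₂))))) ≫ hV₁.fromSpec := by
    rw [hcC, Category.assoc, hc₁, ← Category.assoc, ← Spec.map_comp, ← CommRingCat.ofHom_comp]
  exact functionFieldEquiv_symm_algebraMap_of_comp_eq_fromSpec cC (fst 𝒳 𝒳).left hV₁ _ hfac b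

omit [IsDominant (fst 𝒳 𝒳).left] [Nonempty V₁] in
include hcC hj in
/-- `j (ι₂ b) ≠ 0` as soon as `b` is a non-zero rational function (e.g. `b = ϖ|_{V₂}` for a uniformiser:
the hypothesis `hπ0` of ★ `isUnit_of_cocycle_identity`). [cite: GortzWedhorn2020, Prop. 3.29 (1)] -/
theorem coreUnit_j_includeRight_ne_zero
    (hc₂ : c ≫ (snd 𝒳 𝒳).left = Spec.map (CommRingCat.ofHom (Algebra.TensorProduct.includeRight (R := R)
      (A := Γ(𝒳.left, V₁)) (B := Γ(𝒳.left, V₂))).toRingHom) ≫ hV₂.fromSpec) (b : Γ(𝒳.left, V₂))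
    (hb : algebraMap Γ(𝒳.left, V₂) 𝒳.left.functionField b ≠ 0) :
    j (algebraMap _ C ((1 : Γ(𝒳.left, V₁)) ⊗ₜ[R] b)) ≠ 0 := by
  rw [coreUnit_j_includeRight 𝒳 hV₂ c C cC hcC j hj hc₂ b]
  exact (map_ne_zero_iff _ (functionFieldMap (snd 𝒳 𝒳).left).injective).mpr hb

/-! ### `j ∘ m♯ = m♯_{K} ∘ i_{V₂}` and the `R`-linearity of the shear on function fields -/

omit [IsDominant (fst 𝒳 𝒳).left] [Nonempty V₁] [Algebra R Γ(𝒳.left, V₁)] [Algebra R Γ(𝒳.left, V₂)]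
  [Algebra (Γ(𝒳.left, V₁) ⊗[R] Γ(𝒳.left, V₂)) C] in
include hj in
/-- **`j ∘ m♯ = σ ∘ pr₂♯ ∘ i_{V₂}`**: if `m : D → 𝒳` is given on the chart by `m♯ : Γ(V₂) → C`
(`Spec m♯ ≫ (Spec Γ(V₂) → 𝒳) = ℓ ≫ m` with `ℓ ≫ (D ↪ 𝒳 × 𝒳) = cC`) and `σ` is the endomorphism of
`K(𝒳 × 𝒳)` induced by `Φ_D = (pr₁, m)` (`(D ↪)♯ ∘ σ = Φ_D♯`, `Φ_D ≫ pr₂ = m`), then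
`j (m♯ b) = σ (pr₂♯ b)` for every section `b ∈ Γ(𝒳, V₂)` (★ PCS
`functionFieldMap_functionFieldMap_algebraMap_of_comp_eq_fromSpec` along `ℓ`). [cite: GortzWedhorn2020, Prop. 9.34] -/
theorem coreUnit_j_ms (D : (𝒳 ⊗ 𝒳).left.Opens) [Nonempty D] [IsDominant D.ι]
    (m : (D : Scheme.{u}) ⟶ 𝒳.left) [IsDominant m]
    (ΦD : (D : Scheme.{u}) ⟶ (𝒳 ⊗ 𝒳).left) [IsDominant ΦD] (hΦ₂ : ΦD ≫ (snd 𝒳 𝒳).left = m)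
    (σ : (𝒳 ⊗ 𝒳).left.functionField →+* (𝒳 ⊗ 𝒳).left.functionField)
    (hσ : (functionFieldMap D.ι).comp σ = functionFieldMap ΦD)
    (ℓ : Spec C ⟶ (D : Scheme.{u})) [IsDominant ℓ] (hℓ : ℓ ≫ D.ι = cC)
    (ms : Γ(𝒳.left, V₂) →+* C) (hms : Spec.map (CommRingCat.ofHom ms) ≫ hV₂.fromSpec = ℓ ≫ m)
    (b : Γ(𝒳.left, V₂)) :
    j (ms b) =
      σ (functionFieldMap (snd 𝒳 𝒳).left (algebraMap Γ(𝒳.left, V₂) 𝒳.left.functionField b)) := by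
  subst hj
  apply (functionFieldEquiv cC).injective
  change functionFieldEquiv cC ((functionFieldEquiv cC).symm _) = functionFieldMap cC (σ _)
  rw [RingEquiv.apply_symm_apply]
  -- `cC♯ = ℓ♯ ∘ (D ↪)♯`
  have hcomp : (functionFieldMap ℓ).comp (functionFieldMap D.ι) = functionFieldMap cC := by
    rw [← functionFieldMap_comp D.ι ℓ]
    exact functionFieldMap_congr hℓ
  -- `(D ↪)♯ (σ (pr₂♯ x)) = Φ_D♯ (pr₂♯ x) = m♯ x`
  have hm : ∀ x, functionFieldMap D.ι (σ (functionFieldMap (snd 𝒳 𝒳).left x)) =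
      functionFieldMap m x := fun x => by
    rw [← RingHom.comp_apply (functionFieldMap D.ι) σ, hσ, ← RingHom.comp_apply (functionFieldMap ΦD),
      ← functionFieldMap_comp (snd 𝒳 𝒳).left ΦD, functionFieldMap_congr hΦ₂]
  rw [← hcomp, RingHom.comp_apply, hm]
  exact (functionFieldMap_functionFieldMap_algebraMap_of_comp_eq_fromSpec ℓ m hV₂
    (CommRingCat.ofHom ms) hms.symm b).symm

omit [IsIntegral (𝒳 ⊗ 𝒳).left] [IsDominant (fst 𝒳 𝒳).left] [IsDominant (snd 𝒳 𝒳).left]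
  [Nonempty V₁] in
/-- On sections of the base: `i_{V₂} (r|_{V₂}) = (R → K(𝒳)) r` for the chart algebra structure of
`Γ(𝒳, V₂)` and the structure map ★ `stalkHom` of `K(𝒳)`. [cite: GortzWedhorn2020, (3.4)–(3.5)] -/
theorem algebraMap_sections_algebraMap_eq [Algebra R 𝒳.left.functionField]
    (hRL : algebraMap R 𝒳.left.functionField = stalkHom 𝒳 (genericPoint 𝒳.left))
    (h₂ : algebraMap R Γ(𝒳.left, V₂) = ((Scheme.ΓSpecIso (.of R)).inv ≫ 𝒳.hom.appLE ⊤ V₂ le_top).hom)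
    (r : R) :
    algebraMap Γ(𝒳.left, V₂) 𝒳.left.functionField (algebraMap R Γ(𝒳.left, V₂) r) =
      algebraMap R 𝒳.left.functionField r := by
  have hη : genericPoint 𝒳.left ∈ V₂ := by
    obtain ⟨⟨x, hx⟩⟩ := ‹Nonempty V₂›
    exact ((genericPoint_spec 𝒳.left).specializes (Set.mem_univ x)).mem_open V₂.2 hx
  rw [hRL, ← germ_comp_appLE_eq_stalkHom 𝒳 V₂ (genericPoint 𝒳.left) hη, h₂]
  rfl

omit [IsDominant (fst 𝒳 𝒳).left] [Nonempty V₁] in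
/-- **`pr₂♯` and `σ ∘ pr₂♯` agree on `R`** (the hypothesis `hπφ` of ★ `isUnit_of_cocycle_identity`): for
`r ∈ R`, `pr₂♯ (r) = σ (pr₂♯ (r))`, since `pr₂♯` maps the structure map of `K(𝒳)` to that of
`K(𝒳 × 𝒳)` (★ `functionFieldMap_comp_stalkHom`) and `σ` is `R`-linear (`hσR`).
[cite: GortzWedhorn2020, (3.4)–(3.5) with (11.16)] -/
theorem coreUnit_phi2_algebraMap_eq [Algebra R 𝒳.left.functionField]
    (hRL : algebraMap R 𝒳.left.functionField = stalkHom 𝒳 (genericPoint 𝒳.left))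
    (h₂ : algebraMap R Γ(𝒳.left, V₂) = ((Scheme.ΓSpecIso (.of R)).inv ≫ 𝒳.hom.appLE ⊤ V₂ le_top).hom)
    (σ : (𝒳 ⊗ 𝒳).left.functionField →+* (𝒳 ⊗ 𝒳).left.functionField)
    (hσR : σ.comp (stalkHom (𝒳 ⊗ 𝒳) (genericPoint (𝒳 ⊗ 𝒳).left)) =
      stalkHom (𝒳 ⊗ 𝒳) (genericPoint (𝒳 ⊗ 𝒳).left)) (r : R) :
    functionFieldMap (snd 𝒳 𝒳).left
        (algebraMap Γ(𝒳.left, V₂) 𝒳.left.functionField (algebraMap R Γ(𝒳.left, V₂) r)) =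
      σ (functionFieldMap (snd 𝒳 𝒳).left
        (algebraMap Γ(𝒳.left, V₂) 𝒳.left.functionField (algebraMap R Γ(𝒳.left, V₂) r))) := by
  rw [algebraMap_sections_algebraMap_eq 𝒳 hRL h₂, hRL, ← RingHom.comp_apply (functionFieldMap _),
    functionFieldMap_comp_stalkHom (snd 𝒳 𝒳), ← RingHom.comp_apply σ, hσR]

omit [IsIntegral 𝒳.left] [IsDominant (fst 𝒳 𝒳).left] [IsDominant (snd 𝒳 𝒳).left] [Nonempty V₁]
  [Nonempty V₂] in
/-- **The function-field shear is `R`-linear** (the hypothesis `hσR` below): if `σ` is the endomorphism of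
`K(𝒳 × 𝒳)` induced by a morphism `Φ_D : D → 𝒳 × 𝒳` OVER `R` (`Φ_D ≫ p = (D ↪) ≫ p`, `p` the structure
morphism) through `(D ↪)♯ ∘ σ = Φ_D♯`, then `σ` fixes the structure map `R → K(𝒳 × 𝒳)`
(★ `functionFieldMap_comp_stalkHom` for the two `R`-morphisms `D ↪ 𝒳 × 𝒳` and `Φ_D`).
[cite: GortzWedhorn2020, (3.4)–(3.5) with (11.16)] -/
theorem coreUnit_sigma_comp_stalkHom (D : (𝒳 ⊗ 𝒳).left.Opens) [Nonempty D] [IsDominant D.ι]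
    (ΦD : (D : Scheme.{u}) ⟶ (𝒳 ⊗ 𝒳).left) [IsDominant ΦD]
    (hover : ΦD ≫ (𝒳 ⊗ 𝒳).hom = D.ι ≫ (𝒳 ⊗ 𝒳).hom)
    (σ : (𝒳 ⊗ 𝒳).left.functionField →+* (𝒳 ⊗ 𝒳).left.functionField)
    (hσ : (functionFieldMap D.ι).comp σ = functionFieldMap ΦD) :
    σ.comp (stalkHom (𝒳 ⊗ 𝒳) (genericPoint (𝒳 ⊗ 𝒳).left)) =
      stalkHom (𝒳 ⊗ 𝒳) (genericPoint (𝒳 ⊗ 𝒳).left) := by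
  let 𝒟 : Over (Spec (.of R)) := Over.mk (D.ι ≫ (𝒳 ⊗ 𝒳).hom)
  let ιO : 𝒟 ⟶ 𝒳 ⊗ 𝒳 := Over.homMk D.ι rfl
  let ΦO : 𝒟 ⟶ 𝒳 ⊗ 𝒳 := Over.homMk ΦD hover
  haveI : IsIntegral 𝒟.left := (inferInstance : IsIntegral (D : Scheme.{u}))
  haveI : IsDominant ιO.left := ‹IsDominant D.ι›
  haveI : IsDominant ΦO.left := ‹IsDominant ΦD›
  have h1 : (functionFieldMap D.ι).comp (stalkHom (𝒳 ⊗ 𝒳) (genericPoint (𝒳 ⊗ 𝒳).left)) =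
      stalkHom 𝒟 (genericPoint 𝒟.left) := functionFieldMap_comp_stalkHom ιO
  have h2 : (functionFieldMap ΦD).comp (stalkHom (𝒳 ⊗ 𝒳) (genericPoint (𝒳 ⊗ 𝒳).left)) =
      stalkHom 𝒟 (genericPoint 𝒟.left) := functionFieldMap_comp_stalkHom ΦO
  apply RingHom.ext
  intro r
  apply (functionFieldMap D.ι).injective
  have e1 := RingHom.congr_fun h1 r
  have e2 := RingHom.congr_fun h2 r
  simp only [RingHom.comp_apply] at e1 e2 ⊢
  rw [← RingHom.comp_apply (functionFieldMap D.ι) σ, hσ, e2, e1]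

/-! ### The identity `σ(pr₂♯ f) · j Δ = pr₂♯ f` for the chart Jacobian `Δ` -/

/-- Determinants of bases are multiplicative: `b.det v = b.det b' · b'.det v` (private helper).
[folklore] -/
private theorem det_eq_det_mul_det {ι K M : Type*} [Fintype ι] [DecidableEq ι] [CommRing K]
    [AddCommGroup M] [Module K M] (b b' : Module.Basis ι K M) (v : ι → M) :
    b.det v = b.det b' * b'.det v := by
  rw [Module.Basis.det_apply, Module.Basis.det_apply, Module.Basis.det_apply, ← Matrix.det_mul,
    Module.Basis.toMatrix_mul_toMatrix]

include hcC hj in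
/-- **S7b — the cocycle identity on the chart: `σ(pr₂♯ f) · j Δ = pr₂♯ f`.**  Here `f = f₀ · J` with
`θ = (f₀, y₀)` the rational top form of ★ L4a′ (`d y₀ᵢ` the basis `B₀` of `Ω[K(𝒳)⁄R]`) and
`J = B_y.det B₀` the Jacobian towards the chart coordinates `y` of `V₂` (`d yᵢ` the basis `B_y`),
`Δ = α.det (d m♯yᵢ)ᵢ` the relative Jacobian of `m` on the chart ring `C` in the basis `α = (d (1 ⊗ yᵢ))`
of `Ω[C⁄Γ(V₁)]`, `j : C → K(𝒳 × 𝒳)` the chart map and `σ` the function-field shear; the input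
`hcocy` is the L4c′ identity «`Φ^* pr₂^* θ = pr₂^* θ`» read in the `K(𝒳)`-relative basis of ★ C5′.
Three chain rules (★ `det_D_ringHom_eq` along `j`, `pr₂♯`, `σ ∘ pr₂♯`) and the multiplicativity of
determinants of bases (Bosch–Lütkebohmert–Raynaud, *Néron Models*, §4.3, proof of Prop. 6: the
invariant form makes the Jacobian of the group law a unit). [cite: BLRNeronModels1990, §4.3 Prop. 6 (proof)] -/
theorem coreUnit_cocycle_identity (n : ℕ) [SmoothOfRelativeDimension n 𝒳.hom]
    [Algebra R 𝒳.left.functionField]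
    (hRL : algebraMap R 𝒳.left.functionField = stalkHom 𝒳 (genericPoint 𝒳.left))
    [Algebra 𝒳.left.functionField (𝒳 ⊗ 𝒳).left.functionField]
    (hLM : algebraMap 𝒳.left.functionField (𝒳 ⊗ 𝒳).left.functionField =
      functionFieldMap (fst 𝒳 𝒳).left)
    (hc₁ : c ≫ (fst 𝒳 𝒳).left =
      Spec.map (CommRingCat.ofHom Algebra.TensorProduct.includeLeftRingHom) ≫ hV₁.fromSpec)
    (hc₂ : c ≫ (snd 𝒳 𝒳).left = Spec.map (CommRingCat.ofHom (Algebra.TensorProduct.includeRight (R := R)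
      (A := Γ(𝒳.left, V₁)) (B := Γ(𝒳.left, V₂))).toRingHom) ≫ hV₂.fromSpec)
    [Algebra Γ(𝒳.left, V₁) C] [IsScalarTower Γ(𝒳.left, V₁) (Γ(𝒳.left, V₁) ⊗[R] Γ(𝒳.left, V₂)) C]
    -- the shear: `m` on `D`, `Φ_D = (pr₁, m)`, its function-field endomorphism `σ`, the chart maps
    (D : (𝒳 ⊗ 𝒳).left.Opens) [Nonempty D] [IsDominant D.ι]
    (m : (D : Scheme.{u}) ⟶ 𝒳.left) [IsDominant m]
    (ΦD : (D : Scheme.{u}) ⟶ (𝒳 ⊗ 𝒳).left) [IsDominant ΦD] (hΦ₂ : ΦD ≫ (snd 𝒳 𝒳).left = m)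
    (σ : (𝒳 ⊗ 𝒳).left.functionField →+* (𝒳 ⊗ 𝒳).left.functionField)
    (hσ : (functionFieldMap D.ι).comp σ = functionFieldMap ΦD)
    (hσR : σ.comp (stalkHom (𝒳 ⊗ 𝒳) (genericPoint (𝒳 ⊗ 𝒳).left)) =
      stalkHom (𝒳 ⊗ 𝒳) (genericPoint (𝒳 ⊗ 𝒳).left))
    (ℓ : Spec C ⟶ (D : Scheme.{u})) [IsDominant ℓ] (hℓ : ℓ ≫ D.ι = cC)
    (ms : Γ(𝒳.left, V₂) →+* C) (hms : Spec.map (CommRingCat.ofHom ms) ≫ hV₂.fromSpec = ℓ ≫ m)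
    -- the top form `(f₀, y₀)` and its cocycle identity (L4a′, L4c′)
    (f₀ : 𝒳.left.functionField) (hf₀ : f₀ ≠ 0) (y₀ : Fin n → 𝒳.left.functionField)
    (B₀ : Module.Basis (Fin n) 𝒳.left.functionField Ω[𝒳.left.functionField⁄R])
    (hB₀ : ∀ i, B₀ i = KaehlerDifferential.D R _ (y₀ i))
    (hcocy : ∀ (B₂ : Module.Basis (Fin n) (𝒳 ⊗ 𝒳).left.functionField
        Ω[(𝒳 ⊗ 𝒳).left.functionField⁄𝒳.left.functionField]),
      (∀ i, B₂ i = KaehlerDifferential.D 𝒳.left.functionField _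
        (functionFieldMap (snd 𝒳 𝒳).left (y₀ i))) →
      σ (functionFieldMap (snd 𝒳 𝒳).left f₀) *
        B₂.det (fun i => KaehlerDifferential.D 𝒳.left.functionField _
          (σ (functionFieldMap (snd 𝒳 𝒳).left (y₀ i)))) =
      functionFieldMap (snd 𝒳 𝒳).left f₀)
    -- the chart coordinates `y` on `V₂` and the relative Jacobian basis `α`
    (y : Fin n → Γ(𝒳.left, V₂))
    (B_y : Module.Basis (Fin n) 𝒳.left.functionField Ω[𝒳.left.functionField⁄R])
    (hB_y : ∀ i, B_y i = KaehlerDifferential.D R _ (algebraMap Γ(𝒳.left, V₂) _ (y i)))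
    (α : Module.Basis (Fin n) C Ω[C⁄Γ(𝒳.left, V₁)])
    (hα : ∀ i, α i = KaehlerDifferential.D Γ(𝒳.left, V₁) C
      (algebraMap _ C ((1 : Γ(𝒳.left, V₁)) ⊗ₜ[R] y i))) :
    σ (functionFieldMap (snd 𝒳 𝒳).left (f₀ * B_y.det B₀)) *
        j (α.det fun i => KaehlerDifferential.D Γ(𝒳.left, V₁) C (ms (y i))) =
      functionFieldMap (snd 𝒳 𝒳).left (f₀ * B_y.det B₀) := by
  classical
  -- notation (no `let`: abbreviate by `set … with` only for readability of hypotheses)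
  have hφinj : Function.Injective (functionFieldMap (snd 𝒳 𝒳).left) :=
    (functionFieldMap (snd 𝒳 𝒳).left).injective
  have hσinj : Function.Injective σ := σ.injective
  -- ### the three compatibilities of structure maps
  have hστφ : (functionFieldMap (snd 𝒳 𝒳).left).comp (algebraMap R 𝒳.left.functionField) =
      (algebraMap 𝒳.left.functionField (𝒳 ⊗ 𝒳).left.functionField).comp
        (algebraMap R 𝒳.left.functionField) := by
    rw [hRL, hLM, functionFieldMap_comp_stalkHom (snd 𝒳 𝒳), functionFieldMap_comp_stalkHom (fst 𝒳 𝒳)]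
  have hστμ : (σ.comp (functionFieldMap (snd 𝒳 𝒳).left)).comp (algebraMap R 𝒳.left.functionField) =
      (algebraMap 𝒳.left.functionField (𝒳 ⊗ 𝒳).left.functionField).comp
        (algebraMap R 𝒳.left.functionField) := by
    rw [RingHom.comp_assoc, hστφ, hLM, hRL, functionFieldMap_comp_stalkHom (fst 𝒳 𝒳), hσR]
  have hστj : j.comp (algebraMap Γ(𝒳.left, V₁) C) =
      (algebraMap 𝒳.left.functionField (𝒳 ⊗ 𝒳).left.functionField).comp
        (algebraMap Γ(𝒳.left, V₁) 𝒳.left.functionField) := by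
    ext b
    rw [RingHom.comp_apply, RingHom.comp_apply,
      IsScalarTower.algebraMap_apply Γ(𝒳.left, V₁) (Γ(𝒳.left, V₁) ⊗[R] Γ(𝒳.left, V₂)) C,
      Algebra.TensorProduct.algebraMap_apply, Algebra.algebraMap_self, RingHom.id_apply,
      coreUnit_j_includeLeft 𝒳 hV₁ c C cC hcC j hj hc₁ b, hLM]
  -- ### the `K(𝒳)`-relative bases `d (pr₂♯ yᵢ)` (chart) and `d (pr₂♯ y₀ᵢ)` (top form) — C5′
  obtain ⟨B2y, hB2y⟩ := exists_basis_kaehler_functionField_tensorObj 𝒳 n hRL hLM B_y hB_y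
  obtain ⟨B20, hB20⟩ := exists_basis_kaehler_functionField_tensorObj 𝒳 n hRL hLM B₀ hB₀
  -- ### the basis `d (σ pr₂♯ y₀ᵢ)` from the cocycle identity (its determinant is a unit)
  have hc0 := hcocy B20 hB20
  have hφf₀ : functionFieldMap (snd 𝒳 𝒳).left f₀ ≠ 0 := (map_ne_zero_iff _ hφinj).mpr hf₀
  have hD0unit : IsUnit (B20.det fun i => KaehlerDifferential.D 𝒳.left.functionField _
      (σ (functionFieldMap (snd 𝒳 𝒳).left (y₀ i)))) := by
    refine Ne.isUnit fun h0 => hφf₀ ?_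
    rw [h0, mul_zero] at hc0
    exact hc0.symm
  obtain ⟨hli, hsp⟩ := (Module.Basis.is_basis_iff_det B20).mpr hD0unit
  let Bμ0 : Module.Basis (Fin n) (𝒳 ⊗ 𝒳).left.functionField
      Ω[(𝒳 ⊗ 𝒳).left.functionField⁄𝒳.left.functionField] := Module.Basis.mk hli hsp.ge
  have hBμ0 : ∀ i, Bμ0 i = KaehlerDifferential.D 𝒳.left.functionField _
      ((σ.comp (functionFieldMap (snd 𝒳 𝒳).left)) (y₀ i)) := fun i => Module.Basis.mk_apply hli hsp.ge i
  have hBμ0fun : (⇑Bμ0 : Fin n → _) = fun i => KaehlerDifferential.D 𝒳.left.functionField _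
      (σ (functionFieldMap (snd 𝒳 𝒳).left (y₀ i))) := funext hBμ0
  -- ### the three chain rules
  -- along `σ ∘ pr₂♯` (bases `B₀` over `R`, `Bμ0` over `K(𝒳)`), at `v = iB y`
  have hμchain := det_D_ringHom_eq (algebraMap R 𝒳.left.functionField)
    (σ.comp (functionFieldMap (snd 𝒳 𝒳).left)) hστμ B₀ hB₀ Bμ0 hBμ0
    (fun i => algebraMap Γ(𝒳.left, V₂) 𝒳.left.functionField (y i))
  -- along `pr₂♯` (bases `B_y` over `R`, `B2y` over `K(𝒳)`), at `v = y₀`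
  have hφchain := det_D_ringHom_eq (algebraMap R 𝒳.left.functionField)
    (functionFieldMap (snd 𝒳 𝒳).left) hστφ B_y hB_y B2y hB2y y₀
  -- along `j` (bases `α` over `Γ(V₁)`, `B2y` over `K(𝒳)`), at `v = m♯ y`
  have hB2y' : ∀ i, B2y i = KaehlerDifferential.D 𝒳.left.functionField _
      (j (algebraMap _ C ((1 : Γ(𝒳.left, V₁)) ⊗ₜ[R] y i))) := fun i => by
    rw [hB2y i, coreUnit_j_includeRight 𝒳 hV₂ c C cC hcC j hj hc₂ (y i)]
  have hjchain := det_D_ringHom_eq (algebraMap Γ(𝒳.left, V₁) 𝒳.left.functionField) j hστj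
    α hα B2y hB2y' (fun i => ms (y i))
  -- ### assemble
  have hjms : (fun i => KaehlerDifferential.D 𝒳.left.functionField (𝒳 ⊗ 𝒳).left.functionField
      (j (ms (y i)))) = fun i => KaehlerDifferential.D 𝒳.left.functionField _
      ((σ.comp (functionFieldMap (snd 𝒳 𝒳).left)) (algebraMap Γ(𝒳.left, V₂) _ (y i))) := by
    funext i
    rw [coreUnit_j_ms 𝒳 hV₂ C cC j hj D m ΦD hΦ₂ σ hσ ℓ hℓ ms hms (y i)]
    rfl
  have hB₀fun : (fun j => KaehlerDifferential.D R 𝒳.left.functionField (y₀ j)) = ⇑B₀ :=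
    funext fun j => (hB₀ j).symm
  have hByfun : (fun j => KaehlerDifferential.D R 𝒳.left.functionField
      (algebraMap Γ(𝒳.left, V₂) 𝒳.left.functionField (y j))) = ⇑B_y :=
    funext fun j => (hB_y j).symm
  have hB20fun : (fun j => KaehlerDifferential.D 𝒳.left.functionField (𝒳 ⊗ 𝒳).left.functionField
      (functionFieldMap (snd 𝒳 𝒳).left (y₀ j))) = ⇑B20 := funext fun j => (hB20 j).symm
  -- `J = B_y.det B₀`, `B₀.det B_y = J⁻¹`
  have hJ : B_y.det B₀ ≠ 0 := (B_y.isUnit_det B₀).ne_zero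
  have hJJ : B₀.det B_y * B_y.det B₀ = 1 := by
    rw [Module.Basis.det_apply, Module.Basis.det_apply, ← Matrix.det_mul,
      Module.Basis.toMatrix_mul_toMatrix, Module.Basis.toMatrix_self, Matrix.det_one]
  have hinv : B₀.det B_y = (B_y.det B₀)⁻¹ := eq_inv_of_mul_eq_one_left hJJ
  -- `B2y.det B20 = φ₂ J`
  have hφchain' : B2y.det ⇑B20 = functionFieldMap (snd 𝒳 𝒳).left (B_y.det B₀) := by
    rw [← hB20fun, hφchain, hB₀fun]
  -- `j Δ = φ₂ J · D⁰ · (σ φ₂ J)⁻¹`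
  have hjΔ : j (α.det fun i => KaehlerDifferential.D Γ(𝒳.left, V₁) C (ms (y i))) =
      functionFieldMap (snd 𝒳 𝒳).left (B_y.det B₀) *
        B20.det (fun i => KaehlerDifferential.D 𝒳.left.functionField _
          (σ (functionFieldMap (snd 𝒳 𝒳).left (y₀ i)))) *
        (σ (functionFieldMap (snd 𝒳 𝒳).left (B_y.det B₀)))⁻¹ := by
    rw [← hjchain, hjms, det_eq_det_mul_det B2y Bμ0, hμchain, hByfun, hinv, map_inv₀,
      det_eq_det_mul_det B2y B20 (⇑Bμ0), hBμ0fun, hφchain']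
    rfl
  have hσJ : σ (functionFieldMap (snd 𝒳 𝒳).left (B_y.det B₀)) ≠ 0 :=
    (map_ne_zero_iff _ hσinj).mpr ((map_ne_zero_iff _ hφinj).mpr hJ)
  rw [hjΔ]
  simp only [map_mul]
  have halg : σ (functionFieldMap (snd 𝒳 𝒳).left f₀) *
      σ (functionFieldMap (snd 𝒳 𝒳).left (B_y.det B₀)) *
      (functionFieldMap (snd 𝒳 𝒳).left (B_y.det B₀) *
        B20.det (fun i => KaehlerDifferential.D 𝒳.left.functionField _
          (σ (functionFieldMap (snd 𝒳 𝒳).left (y₀ i)))) *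
        (σ (functionFieldMap (snd 𝒳 𝒳).left (B_y.det B₀)))⁻¹) =
      (σ (functionFieldMap (snd 𝒳 𝒳).left f₀) *
        B20.det (fun i => KaehlerDifferential.D 𝒳.left.functionField _
          (σ (functionFieldMap (snd 𝒳 𝒳).left (y₀ i))))) *
      functionFieldMap (snd 𝒳 𝒳).left (B_y.det B₀) *
      (σ (functionFieldMap (snd 𝒳 𝒳).left (B_y.det B₀)) *
        (σ (functionFieldMap (snd 𝒳 𝒳).left (B_y.det B₀)))⁻¹) := by ring
  rw [halg, mul_inv_cancel₀ hσJ, mul_one, hc0]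

end Literature.NumberTheory.DiophantineGeometry

end
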